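import Summits.RiemannHypothesis.RiemannHypothesis.Theses.WeilParity
import Summits.RiemannHypothesis.RiemannHypothesis.Theorems.WeilParityOffLineParityDetectionTrialCutoff

/-!
# `OffLineParityDetection` (crux stmt-RiemannHypothesis-15431) — stub TORUS: `0 < η₀` is load-bearing

Negative lemma from the standing disprover (refuter-cdisprove-stmt-RiemannHypothesis-15431-0, cycle 1).
In the registered ζ-free stub `stub_torusTopHeavy` of line `registered` the hypothesis `0 < η₀`
cannot be weakened to `0 ≤ η₀`: for a top layer ON the critical line (`η₀ = 0`, `T = {1/2 + i}`)
the "danger" `-gain(a, f) = (∫ f(u) sin(a-u) du)² - (∫ f(u) cos(a-u) du)²` is unbounded on the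
unit sphere — resonant profiles `f(u) = χ(u - c) sin(a - u)` on a long plateau have
`∫ f cos(a-u) = 0`, `∫ f sin(a-u) ≥ R' - 1` and `∫ f² ≤ 2(R' + 1)` — so NO constant `D` satisfies
the danger clause, whatever `δ`, `a`.  Quantitatively this is the statement that the TORUS constants
must blow up like `1/η₀` as the top layer approaches the line.  Statement inlined (the stub's
signature with `0 < η₀` replaced by `0 ≤ η₀`); the plateau is the landed `trial_exists_plateau`.

Axioms: propext, Classical.choice, Quot.sound.
-/

noncomputable section

namespace Summit.RiemannHypothesis.RiemannHypothesis.Theorems.WeilParity.OffLineParityDetection.Negative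

-- `Summit.RiemannHypothesis.RiemannHypothesis.…` repeats a namespace component by design (D-0017 layout).
set_option linter.dupNamespace false

open Set MeasureTheory Complex
open Summit.RiemannHypothesis.RiemannHypothesis.Theorems.WeilParityOffLineParityDetection
  (trial_exists_plateau)

/-- **Resonant profiles.** For every phase `a` and plateau half-length `R' ≥ 1` there is a smooth
real profile `f`, compactly supported in `(0, ∞)`, with `∫ f(u) cos(a-u) du = 0`,
`∫ f(u) sin(a-u) du ≥ R' - 1` and `∫ f² ≤ 2(R' + 1)`: `f(u) = χ(u - c) sin(a - u)` with `χ` an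
even smooth plateau (`= 1` on `[-R', R']`, `= 0` off `[-R'-1, R'+1]`) and `c = a + 2πm ≥ R' + 2`.
[folklore] -/
theorem exists_resonant_profile (a R' : ℝ) (hR' : 1 ≤ R') :
    ∃ f : ℝ → ℝ, ContDiff ℝ (⊤ : ℕ∞) f ∧ HasCompactSupport f ∧ tsupport f ⊆ Set.Ici 0 ∧
      ∫ u in Set.Ioi (0 : ℝ), f u * Real.cos (a - u) = 0 ∧
      R' - 1 ≤ ∫ u in Set.Ioi (0 : ℝ), f u * Real.sin (a - u) ∧
      ∫ u in Set.Ioi (0 : ℝ), f u ^ 2 ≤ 2 * (R' + 1) := by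
  obtain ⟨C, -, hpl⟩ := trial_exists_plateau
  obtain ⟨χ, hχ, hχev, hχ0, hχ1, hχone, hχzero, -, -⟩ := hpl (R' + 1) 1 one_pos
  -- centre `c = a + 2π m` with `c ≥ R' + 2`
  set m : ℕ := ⌈(R' + 2 - a) / (2 * Real.pi)⌉₊ with hm
  set c : ℝ := a + m * (2 * Real.pi) with hc
  have hc2 : R' + 2 ≤ c := by
    have h1 : (R' + 2 - a) / (2 * Real.pi) ≤ m := Nat.le_ceil _
    have h2 : R' + 2 - a ≤ m * (2 * Real.pi) := by
      rwa [div_le_iff₀ (by positivity)] at h1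
    rw [hc]; linarith
  -- the profile
  set f : ℝ → ℝ := fun u ↦ χ (u - c) * Real.sin (a - u) with hf
  have hfK : ∀ u, u ∉ Icc (c - (R' + 1)) (c + (R' + 1)) → f u = 0 := by
    intro u hu
    have habs : R' + 1 ≤ |u - c| := by
      rw [mem_Icc, not_and_or, not_le, not_le] at hu
      rcases hu with h | h
      · rw [abs_of_neg (by linarith)]; linarith
      · rw [abs_of_pos (by linarith)]; linarith
    simp [hf, hχzero _ habs]
  have hfcont : Continuous f :=
    (hχ.continuous.comp (continuous_id.sub continuous_const)).mul
      (Real.continuous_sin.comp (continuous_const.sub continuous_id))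
  have hfsmooth : ContDiff ℝ (⊤ : ℕ∞) f :=
    (hχ.comp (contDiff_id.sub contDiff_const)).mul
      (Real.contDiff_sin.comp (contDiff_const.sub contDiff_id))
  have hfsupp : HasCompactSupport f := HasCompactSupport.intro isCompact_Icc hfK
  have hfint : Integrable f := hfcont.integrable_of_hasCompactSupport hfsupp
  have hfabs : ∀ u, |f u| ≤ 1 := fun u ↦ by
    rw [hf, abs_mul]
    exact mul_le_one₀ (by rw [abs_of_nonneg (hχ0 _)]; exact hχ1 _) (abs_nonneg _)
      (Real.abs_sin_le_one _)
  refine ⟨f, hfsmooth, hfsupp, ?_, ?_, ?_, ?_⟩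
  · -- support in `[c - R' - 1, c + R' + 1] ⊆ (0, ∞)`
    have h1 : tsupport f ⊆ Icc (c - (R' + 1)) (c + (R' + 1)) :=
      closure_minimal (fun u hu ↦ by by_contra h; exact hu (hfK u h)) isClosed_Icc
    exact h1.trans fun u hu ↦ mem_Ici.2 (by linarith [hu.1])
  · -- `A = ∫ f(u) cos(a-u) du = 0` by oddness about `c`
    have hcomp : ∀ u, u ∉ Ioi (0 : ℝ) → f u * Real.cos (a - u) = 0 := fun u hu ↦ by
      rw [hfK u fun h ↦ hu (mem_Ioi.2 (by linarith [h.1])), zero_mul]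
    rw [setIntegral_eq_integral_of_forall_compl_eq_zero hcomp,
      ← integral_add_left_eq_self (fun u ↦ f u * Real.cos (a - u)) c]
    have hodd : ∀ v, f (c + -v) * Real.cos (a - (c + -v)) = -(f (c + v) * Real.cos (a - (c + v))) := by
      intro v
      have h1 : a - (c + -v) = v - m * (2 * Real.pi) := by rw [hc]; ring
      have h2 : a - (c + v) = -v - m * (2 * Real.pi) := by rw [hc]; ring
      simp only [hf, add_sub_cancel_left, h1, h2, Real.sin_sub_nat_mul_two_pi,
        Real.cos_sub_nat_mul_two_pi, Real.sin_neg, Real.cos_neg, hχev v]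
      ring
    have hneg := integral_neg_eq_self (fun v ↦ f (c + v) * Real.cos (a - (c + v))) volume
    simp only [hodd, integral_neg] at hneg
    linarith
  · -- `B = ∫ f(u) sin(a-u) du ≥ ∫_{[c-R', c+R']} sin²(a-u) du ≥ R' - 1`
    have hle : c - R' ≤ c + R' := by linarith
    have hplateau : ∀ u ∈ Icc (c - R') (c + R'), f u * Real.sin (a - u) = Real.sin (a - u) ^ 2 := by
      intro u hu
      have : χ (u - c) = 1 := hχone _ (by rw [abs_le]; constructor <;> linarith [hu.1, hu.2])
      simp [hf, this, sq]
    calc R' - 1 ≤ (Real.sin (a - (c + R')) * Real.cos (a - (c + R')) -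
          Real.sin (a - (c - R')) * Real.cos (a - (c - R')) + (a - (c - R')) - (a - (c + R'))) / 2 := by
          nlinarith [sq_nonneg (Real.sin (a - (c + R')) + Real.cos (a - (c + R'))),
            sq_nonneg (Real.sin (a - (c - R')) - Real.cos (a - (c - R'))),
            Real.sin_sq_add_cos_sq (a - (c + R')), Real.sin_sq_add_cos_sq (a - (c - R'))]
      _ = ∫ x in (a - (c + R'))..(a - (c - R')), Real.sin x ^ 2 := integral_sin_sq.symm
      _ = ∫ u in (c - R')..(c + R'), Real.sin (a - u) ^ 2 :=
          (intervalIntegral.integral_comp_sub_left (fun y ↦ Real.sin y ^ 2) a).symm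
      _ = ∫ u in Icc (c - R') (c + R'), f u * Real.sin (a - u) := by
          rw [intervalIntegral.integral_of_le hle, ← integral_Icc_eq_integral_Ioc,
            setIntegral_congr_fun measurableSet_Icc hplateau]
      _ ≤ ∫ u in Ioi (0 : ℝ), f u * Real.sin (a - u) := by
          apply setIntegral_mono_set
          · exact ((hfcont.mul (Real.continuous_sin.comp
              (continuous_const.sub continuous_id))).integrable_of_hasCompactSupport
              hfsupp.mul_right).integrableOn
          · refine Filter.Eventually.of_forall fun u ↦ ?_
            have : f u * Real.sin (a - u) = χ (u - c) * Real.sin (a - u) ^ 2 := by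
              simp only [hf]; ring
            show (0 : ℝ) ≤ f u * Real.sin (a - u)
            rw [this]
            exact mul_nonneg (hχ0 _) (sq_nonneg _)
          · refine Filter.Eventually.of_forall fun u hu ↦ ?_
            have h1 : c - R' ≤ u := (mem_Icc.1 hu).1
            have h2 : (0 : ℝ) < u := by linarith
            exact h2
  · -- `∫ f² ≤ 2(R' + 1)`
    have hK : Icc (c - (R' + 1)) (c + (R' + 1)) ⊆ Ioi 0 := fun u hu ↦ mem_Ioi.2 (by linarith [hu.1])
    rw [setIntegral_eq_of_subset_of_forall_sdiff_eq_zero measurableSet_Ioi hK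
      (fun u hu ↦ by rw [hfK u hu.2]; ring)]
    calc ∫ u in Icc (c - (R' + 1)) (c + (R' + 1)), f u ^ 2
        ≤ ∫ u in Icc (c - (R' + 1)) (c + (R' + 1)), (1 : ℝ) := by
          refine setIntegral_mono ((hfcont.pow 2).continuousOn.integrableOn_compact isCompact_Icc)
            (continuous_const.continuousOn.integrableOn_compact isCompact_Icc) fun u ↦ ?_
          show f u ^ 2 ≤ 1
          rw [← sq_abs]
          exact pow_le_one₀ (abs_nonneg _) (hfabs u)
      _ = 2 * (R' + 1) := by
          rw [setIntegral_const, smul_eq_mul, mul_one, Real.volume_real_Icc_of_le (by linarith)]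
          ring


/-- Bookkeeping for the top layer `T = {1/2 + i}` on the line: the stub's gain expression is
`(∫ f cos(a-·))² - (∫ f sin(a-·))²`. [folklore] -/
theorem re_phase_sq_laplace {f : ℝ → ℝ} (hf : Continuous f) (hfc : HasCompactSupport f) (a : ℝ) :
    (cexp (2 * (((1 / 2 : ℂ) + I).im : ℂ) * (a : ℂ) * I) *
        (∫ u in Set.Ioi (0 : ℝ), (f u : ℂ) * cexp (-(((1 / 2 : ℂ) + I - 1 / 2) * (u : ℂ)))) ^ 2).re =
      (∫ u in Set.Ioi (0 : ℝ), f u * Real.cos (a - u)) ^ 2 -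
        (∫ u in Set.Ioi (0 : ℝ), f u * Real.sin (a - u)) ^ 2 := by
  have him : ((1 / 2 : ℂ) + I).im = 1 := by simp
  have hsub : (1 / 2 : ℂ) + I - 1 / 2 = I := by ring
  simp only [him, hsub, Complex.ofReal_one, mul_one]
  -- the phase-shifted Laplace transform `W = e^{ia} ∫ f e^{-iu} = ∫ f(u) e^{i(a-u)}`
  set g : ℝ → ℂ := fun u ↦ (f u : ℂ) * cexp (((a - u : ℝ) : ℂ) * I) with hg
  have hgcont : Continuous g :=
    (continuous_ofReal.comp hf).mul (Complex.continuous_exp.comp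
      ((continuous_ofReal.comp (continuous_const.sub continuous_id)).mul continuous_const))
  have hgsupp : HasCompactSupport g := by
    refine hfc.comp_left (g := fun x : ℝ ↦ (x : ℂ)) Complex.ofReal_zero |>.mul_right
  have hgint : Integrable g (volume.restrict (Ioi 0)) :=
    (hgcont.integrable_of_hasCompactSupport hgsupp).integrableOn
  have hW : cexp ((a : ℂ) * I) * ∫ u in Set.Ioi (0 : ℝ), (f u : ℂ) * cexp (-(I * (u : ℂ))) =
      ∫ u in Set.Ioi (0 : ℝ), g u := by
    rw [← integral_const_mul]
    refine setIntegral_congr_fun measurableSet_Ioi fun u _ ↦ ?_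
    rw [hg, mul_left_comm, ← Complex.exp_add]
    congr 1
    push_cast
    ring
  have h2 : cexp (2 * (a : ℂ) * I) = cexp ((a : ℂ) * I) ^ 2 := by
    rw [sq, ← Complex.exp_add]; congr 1; ring
  have hre : (∫ u in Set.Ioi (0 : ℝ), g u).re = ∫ u in Set.Ioi (0 : ℝ), f u * Real.cos (a - u) := by
    have := integral_re hgint
    simp only [RCLike.re_to_complex] at this
    rw [← this]
    refine setIntegral_congr_fun measurableSet_Ioi fun u _ ↦ ?_
    simp only [hg, Complex.re_ofReal_mul, Complex.exp_ofReal_mul_I_re]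
  have him' : (∫ u in Set.Ioi (0 : ℝ), g u).im = ∫ u in Set.Ioi (0 : ℝ), f u * Real.sin (a - u) := by
    have := integral_im hgint
    simp only [RCLike.im_to_complex] at this
    rw [← this]
    refine setIntegral_congr_fun measurableSet_Ioi fun u _ ↦ ?_
    simp only [hg, Complex.im_ofReal_mul, Complex.exp_ofReal_mul_I_im]
  rw [h2, ← mul_pow, hW, sq, Complex.mul_re, hre, him']
  ring

/-- **`0 < η₀` is load-bearing in TORUS (`stub_torusTopHeavy`)**: with `0 < η₀` weakened to
`0 ≤ η₀` the statement is FALSE — witness `η₀ = 0`, `T = {1/2 + i}`, `w = 1`: by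
`exists_resonant_profile` the danger `(∫ f sin(a-·))² - (∫ f cos(a-·))²` exceeds `D ∫ f²` for
every `D`, so the danger clause fails for all `δ`, `a`, `D`. [folklore] -/
theorem stubTorusTopHeavy_false_without_etaPos :
    ¬ ∀ η₀ : ℝ, 0 ≤ η₀ → ∀ T : Finset ℂ, T.Nonempty → (∀ ρ ∈ T, ρ.re = 1 / 2 + η₀) →
      ∀ w : ℂ → ℝ, (∀ ρ ∈ T, 0 < w ρ) →
      ∃ δ : ℝ, 0 < δ ∧ ∃ a : ℝ, ∃ D : ℝ, 0 ≤ D ∧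
        (∀ f : ℝ → ℝ, ContDiff ℝ (⊤ : ℕ∞) f → HasCompactSupport f → tsupport f ⊆ Set.Ici 0 →
          -(∑ ρ ∈ T, w ρ * (Complex.exp (2 * (ρ.im : ℂ) * (a : ℂ) * Complex.I) *
              (∫ u in Set.Ioi (0 : ℝ), (f u : ℂ) * Complex.exp (-((ρ - 1 / 2) * (u : ℂ)))) ^ 2).re)
            ≤ D * ∫ u in Set.Ioi (0 : ℝ), f u ^ 2) ∧
        (∃ f : ℝ → ℝ, ContDiff ℝ (⊤ : ℕ∞) f ∧ HasCompactSupport f ∧ tsupport f ⊆ Set.Ici 0 ∧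
          0 < ∫ u in Set.Ioi (0 : ℝ), f u ^ 2 ∧
          (D + δ) * ∫ u in Set.Ioi (0 : ℝ), f u ^ 2 ≤
            ∑ ρ ∈ T, w ρ * (Complex.exp (2 * (ρ.im : ℂ) * (a : ℂ) * Complex.I) *
              (∫ u in Set.Ioi (0 : ℝ), (f u : ℂ) * Complex.exp (-((ρ - 1 / 2) * (u : ℂ)))) ^ 2).re) := by
  intro h
  obtain ⟨δ, hδ, a, D, hD, hdanger, -⟩ :=
    h 0 le_rfl {(1 / 2 : ℂ) + I} (Finset.singleton_nonempty _)
      (fun ρ hρ ↦ by rw [Finset.mem_singleton.1 hρ]; simp) (fun _ ↦ 1) (fun _ _ ↦ one_pos)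
  obtain ⟨f, hf, hfc, hfs, hA, hB, hN⟩ := exists_resonant_profile a (2 * D + 3) (by linarith)
  have hd := hdanger f hf hfc hfs
  simp only [Finset.sum_singleton, one_mul] at hd
  rw [re_phase_sq_laplace hf.continuous hfc a, hA] at hd
  nlinarith [hd, hB, hN, hD]

end Summit.RiemannHypothesis.RiemannHypothesis.Theorems.WeilParity.OffLineParityDetection.Negative

end
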